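import Mathlib
import Literature.AlgebraicGeometry.HyperbolicPolynomials.Garding
import HarnessLib

/-!
# ValiantsHypothesis / LacunarySymmetroid — crux `MatrixDescartes` (stmt-ValiantsHypothesis-18050, V1),
# line `Cruxes/MatrixDescartes/Lines/lorentzian_shadow.lean`: hyperbolic QUADRATIC forms are Lorentzian
# (tool for the Hessian conjunct (d) of `DetLorentzian`)

Conjunct (d) of the line's `IsLorentzianArray` asks that every Hessian `hessAt c γ` of the `(m−2)`-nd partials
of `det Σ_l s_l A_l` has at most one positive eigenvalue, in the eigenvalue-free form
`0 < vᵀHv → (vᵀHv)(wᵀHw) ≤ (vᵀHw)²`.  Those partials are hyperbolic quadratics (Gårding–Rolle along the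
PSD cone, using the tree's `Literature.AlgebraicGeometry.HyperbolicPolynomials`).  THIS FILE is the last link,
for an arbitrary index type (`0` named facts, no definitions):

* `line_expansion` — for a quadratic form `q` (homogeneous of degree `2`):
  `q(x + t u) = q(x) + t·(q(x+u) − q(x) − q(u)) + t²·q(u)` (the line polynomial of the tree's `linePoly`);
  `eval_smul_two`, `eval_neg_eq` — `q(c x) = c² q(x)`, `q(−x) = q(x)`;
* `polar_sq_ge_of_isHyperbolic` — if `q` is hyperbolic w.r.t. `u` (all `t ↦ q(x + tu)` real-rooted,
  `IsHyperbolic`), then `4 q(u) q(x) ≤ (q(x+u) − q(x) − q(u))²` for every `x` (a real root makes the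
  discriminant a square);
* `isHyperbolic_or_neg_of_eval_pos` — if `q` is hyperbolic w.r.t. `e` with `q(e) > 0` and `q(v) > 0`, then
  `q` is hyperbolic w.r.t. `v` or w.r.t. `−v` (one of `±v` lies in the open cone `Λ₊₊(q,e)`: the sign of the
  linear coefficient decides; then GÅRDING, the tree's `IsHyperbolic.of_mem_openHyperbolicityCone`);
* **`hyperbolic_quadratic_reverse_cauchy_schwarz`** — hence `0 < q(v) → 4 q(v) q(w) ≤ (q(v+w) − q(v) − q(w))²`
  for all `v, w`: the polarisation of a hyperbolic quadratic with a positive value satisfies the reverse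
  Cauchy–Schwarz inequality, i.e. its Hessian has at most one positive eigenvalue (Lorentz signature).

Honest framing: a self-contained tool; conjunct (d) itself (all `m`, definite tuples) is assembled in a
sibling file; `stub_detLorentzian`, the laws, `MatrixDescartes`, Conjecture B and `VP ≠ VNP` stay OPEN here.
-/

-- `Summit.ValiantsHypothesis.ValiantsHypothesis.…` is the tree's mandated single-conjunct layout (Sub = Summit).
set_option linter.dupNamespace false

noncomputable section

namespace Summit.ValiantsHypothesis.ValiantsHypothesis.Theorems.LacunarySymmetroidMatrixDescartes

open MvPolynomial Finset Literature.AlgebraicGeometry.HyperbolicPolynomials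
open scoped BigOperators Polynomial

namespace DetLorentzianHyperbolicQuadratic

variable {σ : Type*} {q : MvPolynomial σ ℝ}

/-! ### Quadratic forms along lines -/

/-- **Line expansion of a quadratic form**: `q(x + t u) = q(x) + t (q(x+u) − q(x) − q(u)) + t² q(u)`.
[folklore] -/
theorem line_expansion (hq : q.IsHomogeneous 2) (x u : σ → ℝ) (t : ℝ) :
    MvPolynomial.eval (x + t • u) q =
      MvPolynomial.eval x q + t * (MvPolynomial.eval (x + u) q - MvPolynomial.eval x q - MvPolynomial.eval u q) +
        t ^ 2 * MvPolynomial.eval u q := by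
  have key : ∀ s : ℝ, MvPolynomial.eval (x + s • u) q =
      MvPolynomial.eval x q + (linePoly q x u).coeff 1 * s + MvPolynomial.eval u q * s ^ 2 := by
    intro s
    have h0 : (linePoly q x u).coeff 0 = MvPolynomial.eval x q := by
      rw [Polynomial.coeff_zero_eq_eval_zero, eval_linePoly, zero_smul, add_zero]
    rw [← eval_linePoly, Polynomial.eval_eq_sum_range'
      (lt_of_le_of_lt (natDegree_linePoly_le hq x u) (by norm_num : 2 < 3))]
    simp only [Finset.sum_range_succ, Finset.sum_range_zero, h0,
      coeff_linePoly_eq_eval hq, zero_add, pow_zero, mul_one, pow_one]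
  have h1 := key 1
  rw [one_smul] at h1
  rw [key t]
  have hc : (linePoly q x u).coeff 1 =
      MvPolynomial.eval (x + u) q - MvPolynomial.eval x q - MvPolynomial.eval u q := by
    linarith
  rw [hc]
  ring

/-- A quadratic form scales quadratically: `q(c x) = c² q(x)`. [folklore] -/
theorem eval_smul_two (hq : q.IsHomogeneous 2) (c : ℝ) (x : σ → ℝ) :
    MvPolynomial.eval (c • x) q = c ^ 2 * MvPolynomial.eval x q := by
  classical
  rw [MvPolynomial.eval_eq, MvPolynomial.eval_eq, Finset.mul_sum]
  refine Finset.sum_congr rfl fun α hα => ?_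
  have hdeg : ∑ i ∈ α.support, α i = 2 := (hq.degree_eq_sum_deg_support hα).symm
  simp_rw [Pi.smul_apply, smul_eq_mul, mul_pow, Finset.prod_mul_distrib, Finset.prod_pow_eq_pow_sum, hdeg]
  ring

/-- A quadratic form is even: `q(−x) = q(x)`. [folklore] -/
theorem eval_neg_eq (hq : q.IsHomogeneous 2) (x : σ → ℝ) :
    MvPolynomial.eval (-x) q = MvPolynomial.eval x q := by
  have h := eval_smul_two hq (-1) x
  rw [neg_one_smul] at h
  rw [h]
  norm_num

/-- The polarisation is odd in the second slot: `q(x − u) − q(x) − q(u) = −(q(x+u) − q(x) − q(u))`.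
[folklore] -/
theorem polar_neg (hq : q.IsHomogeneous 2) (x u : σ → ℝ) :
    MvPolynomial.eval (x + -u) q - MvPolynomial.eval x q - MvPolynomial.eval (-u) q =
      -(MvPolynomial.eval (x + u) q - MvPolynomial.eval x q - MvPolynomial.eval u q) := by
  have h := line_expansion hq x u (-1)
  rw [neg_one_smul] at h
  rw [eval_neg_eq hq, h]
  ring

/-! ### Hyperbolic quadratics -/

/-- **A real root makes the discriminant a square**: if `q` is hyperbolic w.r.t. `u`, then for every `x`
the quadratic `t ↦ q(x + tu) = q(u)t² + (q(x+u) − q(x) − q(u)) t + q(x)` has a real root, so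
`4 q(u) q(x) ≤ (q(x+u) − q(x) − q(u))²`. [folklore] -/
theorem polar_sq_ge_of_isHyperbolic (hq : q.IsHomogeneous 2) {u : σ → ℝ} (hu : IsHyperbolic q u)
    (x : σ → ℝ) :
    4 * MvPolynomial.eval u q * MvPolynomial.eval x q ≤
      (MvPolynomial.eval (x + u) q - MvPolynomial.eval x q - MvPolynomial.eval u q) ^ 2 := by
  classical
  -- a real root `t` of the line polynomial
  have hcard := hu.card_roots_linePoly x
  rw [natDegree_linePoly hq hu.eval_ne_zero x] at hcard
  obtain ⟨t, ht⟩ : ∃ t, t ∈ (linePoly q x u).roots := by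
    by_contra h
    push Not at h
    have h0 : (linePoly q x u).roots = 0 := Multiset.eq_zero_of_forall_notMem h
    rw [h0, Multiset.card_zero] at hcard
    exact absurd hcard (by norm_num)
  have hroot : MvPolynomial.eval (x + t • u) q = 0 := by
    rw [← eval_linePoly]
    exact (Polynomial.mem_roots (linePoly_ne_zero hq hu.eval_ne_zero x)).1 ht
  rw [line_expansion hq x u t] at hroot
  -- `a t² + b t + c = 0` ⇒ `b² − 4ac = (2at + b)² ≥ 0`
  have key : (MvPolynomial.eval (x + u) q - MvPolynomial.eval x q - MvPolynomial.eval u q) ^ 2 -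
      4 * MvPolynomial.eval u q * MvPolynomial.eval x q =
      (2 * MvPolynomial.eval u q * t +
        (MvPolynomial.eval (x + u) q - MvPolynomial.eval x q - MvPolynomial.eval u q)) ^ 2 := by
    linear_combination (-4 * MvPolynomial.eval u q) * hroot
  nlinarith [key, sq_nonneg (2 * MvPolynomial.eval u q * t +
    (MvPolynomial.eval (x + u) q - MvPolynomial.eval x q - MvPolynomial.eval u q))]

/-- **One of `±v` lies in the open cone.** If `q` is hyperbolic w.r.t. `e` with `q(e) > 0` and `q(v) > 0`,
then `q` is hyperbolic w.r.t. `v` or w.r.t. `−v`: according to the sign of the linear coefficient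
`q(v+e) − q(v) − q(e)`, all of `q(±v + τ e)`, `τ ≥ 0`, are `> 0`, so `±v ∈ Λ₊₊(q, e)`, and Gårding's theorem
(`IsHyperbolic.of_mem_openHyperbolicityCone`) applies. [folklore] -/
theorem isHyperbolic_or_neg_of_eval_pos (hq : q.IsHomogeneous 2) {e : σ → ℝ} (he : IsHyperbolic q e)
    (hpos : 0 < MvPolynomial.eval e q) {v : σ → ℝ} (hv : 0 < MvPolynomial.eval v q) :
    IsHyperbolic q v ∨ IsHyperbolic q (-v) := by
  by_cases hL : 0 ≤ MvPolynomial.eval (v + e) q - MvPolynomial.eval v q - MvPolynomial.eval e q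
  · refine Or.inl (he.of_mem_openHyperbolicityCone hq fun τ hτ => ?_)
    rw [line_expansion hq v e τ]
    have : 0 ≤ τ * (MvPolynomial.eval (v + e) q - MvPolynomial.eval v q - MvPolynomial.eval e q) +
        τ ^ 2 * MvPolynomial.eval e q := by positivity
    exact ne_of_gt (by linarith)
  · refine Or.inr (he.of_mem_openHyperbolicityCone hq fun τ hτ => ?_)
    rw [line_expansion hq (-v) e τ, eval_neg_eq hq]
    have hodd : MvPolynomial.eval (-v + e) q - MvPolynomial.eval v q - MvPolynomial.eval e q =
        -(MvPolynomial.eval (v + e) q - MvPolynomial.eval v q - MvPolynomial.eval e q) := by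
      have h := polar_neg hq e v
      rw [add_comm e (-v), add_comm e v, eval_neg_eq hq] at h
      linarith
    rw [hodd]
    have hL' : 0 < -(MvPolynomial.eval (v + e) q - MvPolynomial.eval v q - MvPolynomial.eval e q) := by
      linarith
    have : 0 ≤ τ * -(MvPolynomial.eval (v + e) q - MvPolynomial.eval v q - MvPolynomial.eval e q) +
        τ ^ 2 * MvPolynomial.eval e q := by positivity
    exact ne_of_gt (by linarith)

/-- **Hyperbolic quadratics are Lorentzian (reverse Cauchy–Schwarz).** If the quadratic form `q` is
hyperbolic w.r.t. some `e` with `q(e) > 0`, then for all `v, w` with `q(v) > 0`: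
`4 q(v) q(w) ≤ (q(v+w) − q(v) − q(w))²` — the polarisation `B(v,w) = q(v+w) − q(v) − q(w) = vᵀ(Hess q)w`
satisfies `(vᵀHv)(wᵀHw) ≤ (vᵀHw)²` whenever `vᵀHv = 2q(v) > 0`, i.e. `Hess q` has at most one positive
eigenvalue. [folklore] -/
theorem hyperbolic_quadratic_reverse_cauchy_schwarz (hq : q.IsHomogeneous 2) {e : σ → ℝ}
    (he : IsHyperbolic q e) (hpos : 0 < MvPolynomial.eval e q) (v w : σ → ℝ)
    (hv : 0 < MvPolynomial.eval v q) :
    4 * MvPolynomial.eval v q * MvPolynomial.eval w q ≤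
      (MvPolynomial.eval (v + w) q - MvPolynomial.eval v q - MvPolynomial.eval w q) ^ 2 := by
  have hsq : (MvPolynomial.eval (w + v) q - MvPolynomial.eval w q - MvPolynomial.eval v q) ^ 2 =
      (MvPolynomial.eval (v + w) q - MvPolynomial.eval v q - MvPolynomial.eval w q) ^ 2 := by
    rw [add_comm w v]
    ring
  rcases isHyperbolic_or_neg_of_eval_pos hq he hpos hv with h | h
  · have h1 := polar_sq_ge_of_isHyperbolic hq h w
    rwa [hsq] at h1
  · have h2 := polar_sq_ge_of_isHyperbolic hq h w
    rw [polar_neg hq w v, neg_sq, eval_neg_eq hq, hsq] at h2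
    exact h2

end DetLorentzianHyperbolicQuadratic

end Summit.ValiantsHypothesis.ValiantsHypothesis.Theorems.LacunarySymmetroidMatrixDescartes

end
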